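import Summits.CriticalPhenomena.SAWScalingLimit.Theorems.SAWDefectDecoherenceBoundaryClosureRDevelopingMapCoreLimit
import Summits.CriticalPhenomena.SAWScalingLimit.Theorems.SAWDefectDecoherenceBoundaryClosureRDevelopingMapWeakLimit
import Summits.CriticalPhenomena.SAWScalingLimit.Theorems.SAWDefectDecoherenceConjugateClassNegligibleOfCruxes
import Summits.CriticalPhenomena.SAWScalingLimit.Theorems.SAWDefectDecoherenceBoundaryClosureRPickEngineRemark
import HarnessLib

/-!
# STUB 5b of line `pick-half-plane` (crux `BoundaryClosureR`, stmt-CriticalPhenomena-14004):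
the interior identification of the limit of the developing maps

`developingMapLimitHolomorphic` (registered helper, = the skeleton's
`DevelopingMapLimitHolomorphic` with the line-local definitions `LocalL1Bound`,
`AdmissibleFamily`, `PinnedFlatRoot`, `flatPoints`, `DevelopingMapsConverge`, `IsWeakLimit`,
`IsTest`, `NF` unfolded verbatim, and the constant `α = 12 i`):  if the normalised developing
maps `h_δ = δ(H − H(s_b))/F_δ(b δ)` of the critical parafermionic observable converge locally
uniformly along a mesh sequence `ns` to a continuous `h`, then — given the local `L¹` law and the
route's exponent cruxes `DefectDecoherence`, `MassRatio` — `h` is HOLOMORPHIC on the carrier and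
the normalised bulk functionals `N_{ns n}(ψ) = δ² Σ_z ψ(δ·mid z) F(z)/F(b δ)` converge to
`∫ ψ · (12 i · h')` for every continuous compactly supported `ψ` in the carrier, along the SAME
sequence.

Proof (ingredients landed in the sibling files `…DevelopingMap{Riemann,ByParts,OneScale,
CoreLimit,WeakLimit}`; the two specialisations of the core limit are proved here first): around each interior site the six increments of `h_δ` are
`m_k · δ G(e_k)` (`G = F/F(b δ)`); summing `ψ(δ s)·Σ_k conj(τ)…` by parts and Taylor-expanding in
the hexagon frame gives, for `φ ∈ C²_c`, `N(φ) → −12 i ∫ h ∂φ` (plain cover) and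
`2·(conjugate-class sum of φ) → (24/√3) ∫ h ∂̄φ` (conjugate-class weights); the latter tends to
`0` by `ConjugateClassNegligible` (`conjugateClassNegligible_of_exponent_cruxes`, re-marked at the
pinned root as in `…PickEngineRemark`), so `∫ h ∂̄φ = 0`, whence `h` is holomorphic (Weyl's lemma
`weyl_dbar` + continuity) and `−12 i ∫ h ∂φ = ∫ φ · 12 i h'` (integration by parts); continuous
test functions by density and the local `L¹` law.  References: Duminil-Copin–Smirnov, Ann. of
Math. 175 (2012), §3; H. Weyl (1940); folklore.
-/

noncomputable section

open scoped BigOperators ComplexConjugate Topology ContDiff Classical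
open Filter Set Metric Complex MeasureTheory
open Literature.Probability.LatticeModels Literature.Probability.RandomPlanarGeometry
open Literature.Probability.RandomPlanarGeometry.SAW
open Literature.Analysis.Complex (dbarAlong dbarAlong_one)
open Summit.CriticalPhenomena.SAWScalingLimit.Theses.SAWDefectDecoherence
open Summit.CriticalPhenomena.SAWScalingLimit.Theorems.PickHalfPlane
open Summit.CriticalPhenomena.SAWScalingLimit.Theorems.PickHalfPlane.Hexagon
open Summit.CriticalPhenomena.SAWScalingLimit.Theorems.PickHalfPlane.Engine
open Literature.Barriers.CriticalPhenomena Literature.Barriers.CriticalPhenomena.HexKernel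

namespace Summit.CriticalPhenomena.SAWScalingLimit.Theorems.PickHalfPlane.DevelopingMap

/-! ### The two specialisations: plain cover and conjugate-class weights -/

/-- `2ζ − 1 = i√3`. [folklore] -/
theorem two_triZeta_sub_one : 2 * triZeta - 1 = (Real.sqrt 3 : ℂ) * I := by
  apply Complex.ext <;> simp
  ring

/-- **The normalised functional on a `C²` test function.**  Under the hypotheses of `core_limit`,
`N_{ns n}(φ) = δ² Σ_{z ∈ Ω} φ(δ·mid z) F(z)/F(b δ) → −12 i ∫ h ∂φ` (plain cover `w = 1`,
frame constants `(12(2ζ−1), 0)`, each mid-edge covered twice). [folklore] -/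
theorem functional_limit_smooth (Λ : ℝ → Finset HexVertex) (e b : ℝ → Sym2 HexVertex) {U : Set ℂ}
    (hU : IsOpen U)
    (hexh : ∀ K : Set ℂ, IsCompact K → K ⊆ U →
      ∀ᶠ δ : ℝ in 𝓝[>] 0, ∀ v : HexVertex, (δ : ℂ) * hexCenter v ∈ K → v ∈ Λ δ)
    (hbd : ∀ᶠ δ : ℝ in 𝓝[>] 0, hexDomainSimplyConnected (Λ δ) ∧ e δ ∈ hexDomainBoundary (Λ δ) ∧
      b δ ∈ hexDomainBoundary (Λ δ))
    (hL1 : ∀ K : Set ℂ, IsCompact K → K ⊆ U → ∃ C : ℝ, ∀ᶠ δ : ℝ in 𝓝[>] 0,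
      δ ^ 2 * (∑ᶠ z ∈ {z : Sym2 HexVertex | z ∈ hexDomainMidEdges (Λ δ) ∧ (δ : ℂ) * hexMidpoint z ∈ K},
        ‖hexParafermionicObservable (Λ δ) (e δ) hexCriticalFugacity (5 / 8) z‖) ≤
      C * ‖hexParafermionicObservable (Λ δ) (e δ) hexCriticalFugacity (5 / 8) (b δ)‖)
    {ns : ℕ → ℝ} (hns : Tendsto ns atTop (𝓝[>] 0))
    {h : ℂ → ℂ} (hh : ContinuousOn h U)
    (hconv : ∀ K : Set ℂ, IsCompact K → K ⊆ U → ∀ ε : ℝ, 0 < ε → ∀ᶠ n : ℕ in atTop,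
      ∀ H : Site 2 → ℂ, IsPotential (Λ (ns n)) (e (ns n)) H →
      ∀ (ub wb : HexVertex), b (ns n) = s(ub, wb) →
      ∀ sb : Site 2, sb ∈ hexFaceVertices ub → sb ∈ hexFaceVertices wb →
      ∀ s : Site 2, IsLatticeSite (Λ (ns n)) s → ((ns n : ℝ) : ℂ) * triEmbed s ∈ K →
        ‖((ns n : ℝ) : ℂ) * (H s - H sb) /
            hexParafermionicObservable (Λ (ns n)) (e (ns n)) hexCriticalFugacity (5 / 8) (b (ns n)) -
          h (((ns n : ℝ) : ℂ) * triEmbed s)‖ < ε)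
    {φ : ℂ → ℂ} (hφ : ContDiff ℝ 2 φ) (hφc : HasCompactSupport φ) (hφU : tsupport φ ⊆ U) :
    Tendsto (fun n => ((ns n : ℝ) : ℂ) ^ 2 * (∑ᶠ z ∈ hexDomainMidEdges (Λ (ns n)),
        φ (((ns n : ℝ) : ℂ) * hexMidpoint z) *
          hexParafermionicObservable (Λ (ns n)) (e (ns n)) hexCriticalFugacity (5 / 8) z) /
        hexParafermionicObservable (Λ (ns n)) (e (ns n)) hexCriticalFugacity (5 / 8) (b (ns n))) atTop
      (𝓝 (-(12 * I) * ∫ z, h z * ((2 : ℂ)⁻¹ * (fderiv ℝ φ z 1 - I * fderiv ℝ φ z I)))) := by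
  have hframe : ∀ P Q : ℂ, ∑ k : Fin 6, (fun _ : Fin 6 => (1 : ℂ)) k * (12 * conj (mvec k)) *
      (P * triEmbed (spoke 0 k) + Q * conj (triEmbed (spoke 0 k))) =
      12 * (2 * triZeta - 1) * P + 0 * Q := by
    intro P Q
    simp only [one_mul]
    rw [frame_sum_inv]; ring
  obtain ⟨ε₀, -, hcover, hlim⟩ := core_limit Λ e b hU hexh hbd hL1 hns hh hconv hφ hφc hφU
    (fun _ => 1) (fun _ => by simp) _ _ hframe
  -- identify the limit
  have h3 : (Real.sqrt 3 : ℂ) ≠ 0 :=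
    Complex.ofReal_ne_zero.2 (Real.sqrt_pos.2 (by norm_num : (0 : ℝ) < 3)).ne'
  have hval : (2 : ℂ)⁻¹ * -(((2 / Real.sqrt 3 : ℝ) : ℂ) *
      ∫ z, h z * (12 * (2 * triZeta - 1) * ((2 : ℂ)⁻¹ * (fderiv ℝ φ z 1 - I * fderiv ℝ φ z I)) +
        0 * dbarAlong 1 φ z)) =
      -(12 * I) * ∫ z, h z * ((2 : ℂ)⁻¹ * (fderiv ℝ φ z 1 - I * fderiv ℝ φ z I)) := by
    have hI : ∫ z, h z * (12 * (2 * triZeta - 1) * ((2 : ℂ)⁻¹ * (fderiv ℝ φ z 1 - I * fderiv ℝ φ z I)) +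
        0 * dbarAlong 1 φ z) = 12 * (2 * triZeta - 1) *
        ∫ z, h z * ((2 : ℂ)⁻¹ * (fderiv ℝ φ z 1 - I * fderiv ℝ φ z I)) := by
      rw [← integral_const_mul]
      exact integral_congr_ae (Eventually.of_forall fun z => by simp only [zero_mul, add_zero]; ring)
    rw [hI, two_triZeta_sub_one]
    have h23 : ((2 / Real.sqrt 3 : ℝ) : ℂ) = 2 / (Real.sqrt 3 : ℂ) := by push_cast; ring
    rw [h23]
    field_simp
  rw [← hval]
  refine (hlim.const_mul (2 : ℂ)⁻¹).congr' ?_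
  filter_upwards [hcover] with n hn
  -- the double sum is twice the mid-edge sum
  have hcov := pickEngine_midEdgeCover (Λ (ns n)) _
    (fun z => φ (((ns n : ℝ) : ℂ) * hexMidpoint z) *
      (hexParafermionicObservable (Λ (ns n)) (e (ns n)) hexCriticalFugacity (5 / 8) z /
        hexParafermionicObservable (Λ (ns n)) (e (ns n)) hexCriticalFugacity (5 / 8) (b (ns n))))
    (fun s k hne => by
      refine hn s k (self_subset_cthickening _ ?_)
      exact subset_tsupport _ (Function.mem_support.2 fun h0 => hne (by rw [h0, zero_mul])))
  have h1 : ∑ s ∈ ((Λ (ns n)).biUnion hexFaceVertices).filter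
        (fun s => ((ns n : ℝ) : ℂ) * triEmbed s ∈ cthickening (2 * ε₀) (tsupport φ)),
      ∑ k : Fin 6, φ (((ns n : ℝ) : ℂ) * hexMidpoint (edge s k)) * (fun _ : Fin 6 => (1 : ℂ)) k *
        (hexParafermionicObservable (Λ (ns n)) (e (ns n)) hexCriticalFugacity (5 / 8) (edge s k) /
          hexParafermionicObservable (Λ (ns n)) (e (ns n)) hexCriticalFugacity (5 / 8) (b (ns n))) =
      ∑ s ∈ ((Λ (ns n)).biUnion hexFaceVertices).filter
        (fun s => ((ns n : ℝ) : ℂ) * triEmbed s ∈ cthickening (2 * ε₀) (tsupport φ)),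
      ∑ k : Fin 6, φ (((ns n : ℝ) : ℂ) * hexMidpoint (edge s k)) *
        (hexParafermionicObservable (Λ (ns n)) (e (ns n)) hexCriticalFugacity (5 / 8) (edge s k) /
          hexParafermionicObservable (Λ (ns n)) (e (ns n)) hexCriticalFugacity (5 / 8) (b (ns n))) :=
    Finset.sum_congr rfl fun s _ => Finset.sum_congr rfl fun k _ => by ring
  have h2 : (∑ᶠ z ∈ hexDomainMidEdges (Λ (ns n)), φ (((ns n : ℝ) : ℂ) * hexMidpoint z) *
      (hexParafermionicObservable (Λ (ns n)) (e (ns n)) hexCriticalFugacity (5 / 8) z /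
        hexParafermionicObservable (Λ (ns n)) (e (ns n)) hexCriticalFugacity (5 / 8) (b (ns n)))) =
      (∑ᶠ z ∈ hexDomainMidEdges (Λ (ns n)), φ (((ns n : ℝ) : ℂ) * hexMidpoint z) *
        hexParafermionicObservable (Λ (ns n)) (e (ns n)) hexCriticalFugacity (5 / 8) z) /
        hexParafermionicObservable (Λ (ns n)) (e (ns n)) hexCriticalFugacity (5 / 8) (b (ns n)) := by
    simp only [div_eq_mul_inv]
    rw [finsum_mem_mul]
    exact finsum_mem_congr rfl fun z _ => by ring
  rw [h1, hcov, h2]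
  ring

/-- **The limit is weakly `∂̄`-closed.**  Under the hypotheses of `core_limit`, if the route's
conjugate-class sums of `φ` tend to `0` along the mesh sequence (`ConjugateClassNegligible`), then
`∫ h ∂̄φ = 0` (conjugate-class weights `w = conj u`, frame constants `(0, −12)`). [folklore] -/
theorem integral_dbar_eq_zero (Λ : ℝ → Finset HexVertex) (e b : ℝ → Sym2 HexVertex) {U : Set ℂ}
    (hU : IsOpen U)
    (hexh : ∀ K : Set ℂ, IsCompact K → K ⊆ U →
      ∀ᶠ δ : ℝ in 𝓝[>] 0, ∀ v : HexVertex, (δ : ℂ) * hexCenter v ∈ K → v ∈ Λ δ)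
    (hbd : ∀ᶠ δ : ℝ in 𝓝[>] 0, hexDomainSimplyConnected (Λ δ) ∧ e δ ∈ hexDomainBoundary (Λ δ) ∧
      b δ ∈ hexDomainBoundary (Λ δ))
    (hL1 : ∀ K : Set ℂ, IsCompact K → K ⊆ U → ∃ C : ℝ, ∀ᶠ δ : ℝ in 𝓝[>] 0,
      δ ^ 2 * (∑ᶠ z ∈ {z : Sym2 HexVertex | z ∈ hexDomainMidEdges (Λ δ) ∧ (δ : ℂ) * hexMidpoint z ∈ K},
        ‖hexParafermionicObservable (Λ δ) (e δ) hexCriticalFugacity (5 / 8) z‖) ≤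
      C * ‖hexParafermionicObservable (Λ δ) (e δ) hexCriticalFugacity (5 / 8) (b δ)‖)
    {ns : ℕ → ℝ} (hns : Tendsto ns atTop (𝓝[>] 0))
    {h : ℂ → ℂ} (hh : ContinuousOn h U)
    (hconv : ∀ K : Set ℂ, IsCompact K → K ⊆ U → ∀ ε : ℝ, 0 < ε → ∀ᶠ n : ℕ in atTop,
      ∀ H : Site 2 → ℂ, IsPotential (Λ (ns n)) (e (ns n)) H →
      ∀ (ub wb : HexVertex), b (ns n) = s(ub, wb) →
      ∀ sb : Site 2, sb ∈ hexFaceVertices ub → sb ∈ hexFaceVertices wb →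
      ∀ s : Site 2, IsLatticeSite (Λ (ns n)) s → ((ns n : ℝ) : ℂ) * triEmbed s ∈ K →
        ‖((ns n : ℝ) : ℂ) * (H s - H sb) /
            hexParafermionicObservable (Λ (ns n)) (e (ns n)) hexCriticalFugacity (5 / 8) (b (ns n)) -
          h (((ns n : ℝ) : ℂ) * triEmbed s)‖ < ε)
    {φ : ℂ → ℂ} (hφ : ContDiff ℝ 2 φ) (hφc : HasCompactSupport φ) (hφU : tsupport φ ⊆ U)
    (hCC : Tendsto (fun n => ((ns n : ℝ) : ℂ) ^ 2 * (∑ᶠ p ∈ {p : HexVertex × HexVertex |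
        s(p.1, p.2) ∈ hexDomainMidEdges (Λ (ns n)) ∧ p.1.2 = 0},
        φ (((ns n : ℝ) : ℂ) * hexMidpoint s(p.1, p.2)) * conj (hexCenter p.2 - hexCenter p.1) *
          hexParafermionicObservable (Λ (ns n)) (e (ns n)) hexCriticalFugacity (5 / 8) s(p.1, p.2)) /
        hexParafermionicObservable (Λ (ns n)) (e (ns n)) hexCriticalFugacity (5 / 8) (b (ns n))) atTop
      (𝓝 0)) :
    ∫ z, h z * dbarAlong 1 φ z = 0 := by
  have hw : ∀ k, ‖conj ((![vecB, vecA, vecC, vecB, vecA, vecC] : Fin 6 → ℂ) k)‖ ≤ 1 := fun k => by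
    rw [Complex.norm_conj]; exact norm_orient_le k
  have hframe : ∀ P Q : ℂ, ∑ k : Fin 6,
      (fun k => conj ((![vecB, vecA, vecC, vecB, vecA, vecC] : Fin 6 → ℂ) k)) k * (12 * conj (mvec k)) *
      (P * triEmbed (spoke 0 k) + Q * conj (triEmbed (spoke 0 k))) = 0 * P + (-12) * Q := by
    intro P Q
    rw [frame_sum_conj_inv]; ring
  obtain ⟨ε₀, -, hcover, hlim⟩ := core_limit Λ e b hU hexh hbd hL1 hns hh hconv hφ hφc hφU
    (fun k => conj ((![vecB, vecA, vecC, vecB, vecA, vecC] : Fin 6 → ℂ) k)) hw _ _ hframe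
  -- the double sum is twice the conjugate-class sum, hence tends to `0`
  have hlim0 : Tendsto (fun n => ((ns n : ℝ) : ℂ) ^ 2 *
      ∑ s ∈ ((Λ (ns n)).biUnion hexFaceVertices).filter
          (fun s => ((ns n : ℝ) : ℂ) * triEmbed s ∈ cthickening (2 * ε₀) (tsupport φ)),
        ∑ k : Fin 6, φ (((ns n : ℝ) : ℂ) * hexMidpoint (edge s k)) *
          (fun k => conj ((![vecB, vecA, vecC, vecB, vecA, vecC] : Fin 6 → ℂ) k)) k *
          (hexParafermionicObservable (Λ (ns n)) (e (ns n)) hexCriticalFugacity (5 / 8) (edge s k) /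
            hexParafermionicObservable (Λ (ns n)) (e (ns n)) hexCriticalFugacity (5 / 8) (b (ns n))))
      atTop (𝓝 (2 * 0)) := by
    refine (hCC.const_mul 2).congr' ?_
    filter_upwards [hcover] with n hn
    have hcov := pickEngine_midEdgeCover_conj (Λ (ns n)) _
      (fun z => φ (((ns n : ℝ) : ℂ) * z))
      (fun z => hexParafermionicObservable (Λ (ns n)) (e (ns n)) hexCriticalFugacity (5 / 8) z /
        hexParafermionicObservable (Λ (ns n)) (e (ns n)) hexCriticalFugacity (5 / 8) (b (ns n)))
      (fun s k hne => by
        refine hn s k (self_subset_cthickening _ ?_)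
        exact subset_tsupport _ (Function.mem_support.2 hne))
    have h2 : (∑ᶠ p ∈ {p : HexVertex × HexVertex | s(p.1, p.2) ∈ hexDomainMidEdges (Λ (ns n)) ∧ p.1.2 = 0},
        φ (((ns n : ℝ) : ℂ) * hexMidpoint s(p.1, p.2)) * conj (hexCenter p.2 - hexCenter p.1) *
          (hexParafermionicObservable (Λ (ns n)) (e (ns n)) hexCriticalFugacity (5 / 8) s(p.1, p.2) /
            hexParafermionicObservable (Λ (ns n)) (e (ns n)) hexCriticalFugacity (5 / 8) (b (ns n)))) =
        (∑ᶠ p ∈ {p : HexVertex × HexVertex | s(p.1, p.2) ∈ hexDomainMidEdges (Λ (ns n)) ∧ p.1.2 = 0},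
          φ (((ns n : ℝ) : ℂ) * hexMidpoint s(p.1, p.2)) * conj (hexCenter p.2 - hexCenter p.1) *
            hexParafermionicObservable (Λ (ns n)) (e (ns n)) hexCriticalFugacity (5 / 8) s(p.1, p.2)) /
          hexParafermionicObservable (Λ (ns n)) (e (ns n)) hexCriticalFugacity (5 / 8) (b (ns n)) := by
      simp only [div_eq_mul_inv]
      rw [finsum_mem_mul]
      exact finsum_mem_congr rfl fun z _ => by ring
    show 2 * _ = _
    rw [hcov, h2]
    dsimp only [Set.mem_setOf_eq]
    ring
  rw [mul_zero] at hlim0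
  have heq := tendsto_nhds_unique hlim hlim0
  have h3 : (((2 / Real.sqrt 3 : ℝ) : ℂ)) ≠ 0 := by
    have : (0 : ℝ) < 2 / Real.sqrt 3 := by positivity
    exact Complex.ofReal_ne_zero.2 this.ne'
  have hI : ∫ z, h z * (0 * ((2 : ℂ)⁻¹ * (fderiv ℝ φ z 1 - I * fderiv ℝ φ z I)) +
      (-12) * dbarAlong 1 φ z) = (-12) * ∫ z, h z * dbarAlong 1 φ z := by
    rw [← integral_const_mul]
    exact integral_congr_ae (Eventually.of_forall fun z => by simp only [zero_mul, zero_add]; ring)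
  rw [hI, neg_eq_zero, mul_eq_zero, mul_eq_zero] at heq
  rcases heq with h0 | h12 | hint
  · exact absurd h0 h3
  · norm_num at h12
  · exact hint


/-- **Registered helper `developingMapLimitHolomorphic_smooth`** (crux stmt-CriticalPhenomena-14004, line
`pick-half-plane`, stub `stub_developingMapLimitHolomorphic`): registry form (one `∀`-term) of
`functional_limit_smooth`. [folklore] -/
theorem developingMapLimitHolomorphic_smooth : ∀ (Λ : ℝ → Finset HexVertex) (e b : ℝ → Sym2 HexVertex) {U : Set ℂ} (hU : IsOpen U) (hexh : ∀ K : Set ℂ, IsCompact K → K ⊆ U → ∀ᶠ δ : ℝ in 𝓝[>] 0, ∀ v : HexVertex, (δ : ℂ) * hexCenter v ∈ K → v ∈ Λ δ) (hbd : ∀ᶠ δ : ℝ in 𝓝[>] 0, hexDomainSimplyConnected (Λ δ) ∧ e δ ∈ hexDomainBoundary (Λ δ) ∧ b δ ∈ hexDomainBoundary (Λ δ)) (hL1 : ∀ K : Set ℂ, IsCompact K → K ⊆ U → ∃ C : ℝ, ∀ᶠ δ : ℝ in 𝓝[>] 0, δ ^ 2 * (∑ᶠ z ∈ {z : Sym2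 HexVertex | z ∈ hexDomainMidEdges (Λ δ) ∧ (δ : ℂ) * hexMidpoint z ∈ K}, ‖hexParafermionicObservable (Λ δ) (e δ) hexCriticalFugacity (5 / 8) z‖) ≤ C * ‖hexParafermionicObservable (Λ δ) (e δ) hexCriticalFugacity (5 / 8) (b δ)‖) {ns : ℕ → ℝ} (hns : Tendsto ns atTop (𝓝[>] 0)) {h : ℂ → ℂ} (hh : ContinuousOn h U) (hconv : ∀ K : Set ℂ, IsCompact K → K ⊆ U → ∀ ε : ℝ, 0 < ε → ∀ᶠ n : ℕ in atTop, ∀ H : Site 2 → ℂ, IsPotential (Λ (ns n)) (e (ns n)) H → ∀ (ub wb : HexVertex), b (ns n) = s(ub, wb) → ∀ sb : Site 2, sb ∈ hexFaceVertices ub → sb ∈ hexFaceVertices wb → ∀ s : Site 2, IsLatticeSite (Λ (ns n)) s → ((ns n : ℝ) : ℂ) * triEmbed s ∈ K → ‖((ns n : ℝ) : ℂ) * (H s - H sb) / hexParafermionicObservable (Λ (ns n)) (e (ns n)) hexCriticalFugacity (5 / 8) (b (ns n)) - h (((ns n : ℝ) : ℂ) * triEmbed s)‖ < ε) {φ : ℂ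 → ℂ} (hφ : ContDiff ℝ 2 φ) (hφc : HasCompactSupport φ) (hφU : tsupport φ ⊆ U), Tendsto (fun n => ((ns n : ℝ) : ℂ) ^ 2 * (∑ᶠ z ∈ hexDomainMidEdges (Λ (ns n)), φ (((ns n : ℝ) : ℂ) * hexMidpoint z) * hexParafermionicObservable (Λ (ns n)) (e (ns n)) hexCriticalFugacity (5 / 8) z) / hexParafermionicObservable (Λ (ns n)) (e (ns n)) hexCriticalFugacity (5 / 8) (b (ns n))) atTop (𝓝 (-(12 * I) * ∫ z, h z * ((2 : ℂ)⁻¹ * (fderiv ℝ φ z 1 - I * fderiv ℝ φ z I)))) :=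
  @functional_limit_smooth

/-! ### Assembly -/


/-- **The conjugate-class sums along a mesh sequence at a pinned flat root.**  For an admissible
family and a pinned flat root `x ≠ D.pt 1` (skeleton binders, unfolded), the route's
`ConjugateClassNegligible` — stated for roots converging to `D.pt 0` — applies after re-marking
the domain at `x` (`exists_dobrushinDomain_pt_zero_eq`): the conjugate-class sums of every
`C¹` compactly supported `ψ` in the carrier tend to `0` along `ns`. [folklore] -/
theorem conjugateClass_tendsto_zero (hCCN : ConjugateClassNegligible)
    (D : DobrushinDomain) (ρ : ℝ) (Λ : ℝ → Finset HexVertex) (m : ℝ → ℤ) (b : ℝ → Sym2 HexVertex)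
    (hρ : 0 < ρ)
    (hflat1 : D.carrier ∩ Metric.ball (D.pt 1) ρ = {z : ℂ | (D.pt 1).im < z.im} ∩ Metric.ball (D.pt 1) ρ)
    (hadm : ∀ᶠ δ : ℝ in 𝓝[>] 0, hexDomainSimplyConnected (Λ δ) ∧ b δ ∈ hexDomainBoundary (Λ δ) ∧
        (hexGraph.induce ((Λ δ : Finset HexVertex) : Set HexVertex)).Preconnected ∧
        (∀ v ∈ Λ δ, (δ : ℂ) * hexCenter v ∈ D.carrier) ∧
        (∀ v : HexVertex, (δ : ℂ) * hexCenter v ∈ Metric.ball (D.pt 1) ρ → (v ∈ Λ δ ↔ m δ ≤ v.1 1)))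
    (hexh : ∀ K : Set ℂ, IsCompact K → K ⊆ D.carrier →
        ∀ᶠ δ : ℝ in 𝓝[>] 0, ∀ v : HexVertex, (δ : ℂ) * hexCenter v ∈ K → v ∈ Λ δ)
    (hb : Tendsto (fun δ : ℝ => (δ : ℂ) * hexMidpoint (b δ)) (𝓝[>] 0) (𝓝 (D.pt 1)))
    (x : ℂ) (e : ℝ → Sym2 HexVertex) (r : ℝ) (hr : 0 < r)
    (hflatx : D.carrier ∩ Metric.ball x r = {z : ℂ | x.im < z.im} ∩ Metric.ball x r)
    (hroot : ∀ᶠ δ : ℝ in 𝓝[>] 0, e δ ∈ hexDomainBoundary (Λ δ) ∧ Nonempty (HexMidEdgeSAW (Λ δ) (e δ) (b δ)))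
    (he : Tendsto (fun δ : ℝ => (δ : ℂ) * hexMidpoint (e δ)) (𝓝[>] 0) (𝓝 x)) (hx : x ≠ D.pt 1)
    {ns : ℕ → ℝ} (hns : Tendsto ns atTop (𝓝[>] 0))
    {ψ : ℂ → ℂ} (hψ : ContDiff ℝ 1 ψ) (hψc : HasCompactSupport ψ) (hψD : tsupport ψ ⊆ D.carrier) :
    Tendsto (fun n => ((ns n : ℝ) : ℂ) ^ 2 * (∑ᶠ p ∈ {p : HexVertex × HexVertex |
        s(p.1, p.2) ∈ hexDomainMidEdges (Λ (ns n)) ∧ p.1.2 = 0},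
        ψ (((ns n : ℝ) : ℂ) * hexMidpoint s(p.1, p.2)) * conj (hexCenter p.2 - hexCenter p.1) *
          hexParafermionicObservable (Λ (ns n)) (e (ns n)) hexCriticalFugacity (5 / 8) s(p.1, p.2)) /
        hexParafermionicObservable (Λ (ns n)) (e (ns n)) hexCriticalFugacity (5 / 8) (b (ns n))) atTop
      (𝓝 0) := by
  -- adapted from `LocalL1.weakDbar_functional` (re-marking the root)
  obtain ⟨hxfr, -⟩ := mem_frontier_of_flat_piece D hr hflatx
  obtain ⟨D', hcar, h0, h1⟩ := exists_dobrushinDomain_pt_zero_eq D hxfr hx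
  have hadm' : ∀ᶠ δ : ℝ in 𝓝[>] 0, hexDomainSimplyConnected (Λ δ) ∧
      e δ ∈ hexDomainBoundary (Λ δ) ∧ b δ ∈ hexDomainBoundary (Λ δ) ∧
      Nonempty (HexMidEdgeSAW (Λ δ) (e δ) (b δ)) ∧
      (hexGraph.induce ((Λ δ : Finset HexVertex) : Set HexVertex)).Preconnected ∧
      (∀ v ∈ Λ δ, (δ : ℂ) * hexCenter v ∈ D'.carrier) ∧
      (∀ v : HexVertex, (δ : ℂ) * hexCenter v ∈ Metric.ball (D'.pt 1) ρ →
        (v ∈ Λ δ ↔ m δ ≤ v.1 1)) := by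
    filter_upwards [hadm, hroot] with δ hδ hδ'
    rw [hcar, h1]
    exact ⟨hδ.1, hδ'.1, hδ.2.1, hδ'.2, hδ.2.2.1, hδ.2.2.2.1, hδ.2.2.2.2⟩
  have hflat1' : D'.carrier ∩ Metric.ball (D'.pt 1) ρ =
      {z : ℂ | (D'.pt 1).im < z.im} ∩ Metric.ball (D'.pt 1) ρ := by rw [hcar, h1]; exact hflat1
  have hexh' : ∀ K : Set ℂ, IsCompact K → K ⊆ D'.carrier →
      ∀ᶠ δ : ℝ in 𝓝[>] 0, ∀ v : HexVertex, (δ : ℂ) * hexCenter v ∈ K → v ∈ Λ δ := by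
    rw [hcar]; exact hexh
  have he' : Tendsto (fun δ : ℝ => (δ : ℂ) * hexMidpoint (e δ)) (𝓝[>] 0) (𝓝 (D'.pt 0)) := by
    rw [h0]; exact he
  have hb' : Tendsto (fun δ : ℝ => (δ : ℂ) * hexMidpoint (b δ)) (𝓝[>] 0) (𝓝 (D'.pt 1)) := by
    rw [h1]; exact hb
  have hψD' : tsupport ψ ⊆ D'.carrier := by rw [hcar]; exact hψD
  have hCC0 := hCCN D' ρ Λ m e b ψ hρ hflat1' hadm' hexh' he' hb' hψ hψc hψD'
  exact hCC0.comp hns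

/-- Smooth functions are `C²` and `C¹` (exponent bookkeeping). [folklore] -/
theorem contDiff_two_of_smooth {φ : ℂ → ℂ} (hφ : ContDiff ℝ ∞ φ) : ContDiff ℝ 2 φ ∧ ContDiff ℝ 1 φ := by
  have h2 : ContDiff ℝ 2 φ := hφ.of_le (by
    change ((2 : ℕ∞) : WithTop ℕ∞) ≤ ((⊤ : ℕ∞) : WithTop ℕ∞)
    exact WithTop.coe_le_coe.2 le_top)
  exact ⟨h2, h2.of_le (by norm_num)⟩

/-- **STUB 5b — the interior identification of the limit of the developing maps** (registered
helper `developingMapLimitHolomorphic` of crux stmt-CriticalPhenomena-14004, line `pick-half-plane`;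
the skeleton's `DevelopingMapLimitHolomorphic` unfolded, `α = 12 i`).  See the module docstring.
[folklore] -/
theorem developingMapLimitHolomorphic : ∃ α : ℂ, α ≠ 0 ∧ ((∀ (D : DobrushinDomain) (ρ : ℝ) (Λ : ℝ → Finset HexVertex) (m : ℝ → ℤ) (b : ℝ → Sym2 HexVertex), (0 < ρ ∧ D.carrier ∩ Metric.ball (D.pt 1) ρ = {z : ℂ | (D.pt 1).im < z.im} ∩ Metric.ball (D.pt 1) ρ ∧ (∀ᶠ δ : ℝ in 𝓝[>] 0, hexDomainSimplyConnected (Λ δ) ∧ b δ ∈ hexDomainBoundary (Λ δ) ∧ (hexGraph.induce ((Λ δ : Finset HexVertex) : Set HexVertex)).Preconnected ∧ (∀ v ∈ Λ δ, (δ : ℂ) * hexCenter v ∈ D.carrier) ∧ (∀ v : HexVertex, (δ : ℂ) * hexCenter v ∈ Metric.ball (D.pt 1) ρ → (v ∈ Λ δ ↔ m δ ≤ v.1 1))) ∧ (∀ K : Set ℂ, IsCompact K → K ⊆ D.carrier → ∀ᶠ δ : ℝ in 𝓝[>] 0, ∀ v : HexVertex, (δ : ℂ) * hexCenter v ∈ K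 → v ∈ Λ δ) ∧ Tendsto (fun δ : ℝ => (δ : ℂ) * hexMidpoint (b δ)) (𝓝[>] 0) (𝓝 (D.pt 1))) → ∀ (x : ℂ) (e : ℝ → Sym2 HexVertex) (r : ℝ) (mr : ℝ → ℤ), (0 < r ∧ D.carrier ∩ Metric.ball x r = {z : ℂ | x.im < z.im} ∩ Metric.ball x r ∧ (∀ᶠ δ : ℝ in 𝓝[>] 0, e δ ∈ hexDomainBoundary (Λ δ) ∧ Nonempty (HexMidEdgeSAW (Λ δ) (e δ) (b δ)) ∧ (∀ v : HexVertex, (δ : ℂ) * hexCenter v ∈ Metric.ball x r → (v ∈ Λ δ ↔ mr δ ≤ v.1 1))) ∧ Tendsto (fun δ : ℝ => (δ : ℂ) * hexMidpoint (e δ)) (𝓝[>] 0) (𝓝 x)) → x ≠ D.pt 1 → ∀ K : Set ℂ, IsCompact K → K ⊆ D.carrier → ∃ C : ℝ, ∀ᶠ δ : ℝ in 𝓝[>] 0, δ ^ 2 * (∑ᶠ z ∈ {z : Sym2 HexVertex | z ∈ hexDomainMidEdges (Λ δ) ∧ (δ : ℂ) * hexMidpoint z ∈ K}, ‖hexParafermionicObservable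 (Λ δ) (e δ) hexCriticalFugacity (5 / 8) z‖) ≤ C * ‖hexParafermionicObservable (Λ δ) (e δ) hexCriticalFugacity (5 / 8) (b δ)‖) → DefectDecoherence → MassRatio → ∀ (D : DobrushinDomain) (ρ : ℝ) (Λ : ℝ → Finset HexVertex) (m : ℝ → ℤ) (b : ℝ → Sym2 HexVertex), (0 < ρ ∧ D.carrier ∩ Metric.ball (D.pt 1) ρ = {z : ℂ | (D.pt 1).im < z.im} ∩ Metric.ball (D.pt 1) ρ ∧ (∀ᶠ δ : ℝ in 𝓝[>] 0, hexDomainSimplyConnected (Λ δ) ∧ b δ ∈ hexDomainBoundary (Λ δ) ∧ (hexGraph.induce ((Λ δ : Finset HexVertex) : Set HexVertex)).Preconnected ∧ (∀ v ∈ Λ δ, (δ : ℂ) * hexCenter v ∈ D.carrier) ∧ (∀ v : HexVertex, (δ : ℂ) * hexCenter v ∈ Metric.ball (D.pt 1) ρ → (v ∈ Λ δ ↔ m δ ≤ v.1 1))) ∧ (∀ K : Set ℂ, IsCompact K → K ⊆ D.carrier → ∀ᶠ δ : ℝ in 𝓝[>] 0, ∀ v : HexVertex, (δ : ℂ) * hexCenter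 v ∈ K → v ∈ Λ δ) ∧ Tendsto (fun δ : ℝ => (δ : ℂ) * hexMidpoint (b δ)) (𝓝[>] 0) (𝓝 (D.pt 1))) → ∀ (x : ℂ) (e : ℝ → Sym2 HexVertex) (r : ℝ) (mr : ℝ → ℤ), (0 < r ∧ D.carrier ∩ Metric.ball x r = {z : ℂ | x.im < z.im} ∩ Metric.ball x r ∧ (∀ᶠ δ : ℝ in 𝓝[>] 0, e δ ∈ hexDomainBoundary (Λ δ) ∧ Nonempty (HexMidEdgeSAW (Λ δ) (e δ) (b δ)) ∧ (∀ v : HexVertex, (δ : ℂ) * hexCenter v ∈ Metric.ball x r → (v ∈ Λ δ ↔ mr δ ≤ v.1 1))) ∧ Tendsto (fun δ : ℝ => (δ : ℂ) * hexMidpoint (e δ)) (𝓝[>] 0) (𝓝 x)) → x ≠ D.pt 1 → ∀ ns : ℕ → ℝ, Tendsto ns atTop (𝓝[>] 0) → ∀ h : ℂ → ℂ, ContinuousOn h ((D.carrier ∪ (({z : ℂ | z.im = (D.pt 1).im} ∩ Metric.ball (D.pt 1) ρ) ∪ ({z : ℂ | z.im = x.im} ∩ Metric.ball x r))) \ {x})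 → (∀ K : Set ℂ, IsCompact K → K ⊆ (D.carrier ∪ (({z : ℂ | z.im = (D.pt 1).im} ∩ Metric.ball (D.pt 1) ρ) ∪ ({z : ℂ | z.im = x.im} ∩ Metric.ball x r))) \ {x} → ∀ ε : ℝ, 0 < ε → ∀ᶠ n : ℕ in atTop, ∀ H : Site 2 → ℂ, IsPotential (Λ (ns n)) (e (ns n)) H → ∀ (ub wb : HexVertex), b (ns n) = s(ub, wb) → ∀ sb : Site 2, sb ∈ hexFaceVertices ub → sb ∈ hexFaceVertices wb → ∀ s : Site 2, IsLatticeSite (Λ (ns n)) s → ((ns n : ℝ) : ℂ) * triEmbed s ∈ K → ‖((ns n : ℝ) : ℂ) * (H s - H sb) / hexParafermionicObservable (Λ (ns n)) (e (ns n)) hexCriticalFugacity (5 / 8) (b (ns n)) - h (((ns n : ℝ) : ℂ) * triEmbed s)‖ < ε) → DifferentiableOn ℂ h D.carrier ∧ ∀ ψ : ℂ → ℂ, (Continuous ψ ∧ HasCompactSupport ψ ∧ tsupport ψ ⊆ D.carrier) → Tendsto (fun n => ((ns n : ℝ) : ℂ) ^ 2 * (∑ᶠ z ∈ hexDomainMidEdges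 (Λ (ns n)), ψ (((ns n : ℝ) : ℂ) * hexMidpoint z) * hexParafermionicObservable (Λ (ns n)) (e (ns n)) hexCriticalFugacity (5 / 8) z) / hexParafermionicObservable (Λ (ns n)) (e (ns n)) hexCriticalFugacity (5 / 8) (b (ns n))) atTop (𝓝 (∫ z, ψ z * ((fun z => α * deriv h z) z)))) := by
  refine ⟨12 * I, mul_ne_zero (by norm_num) Complex.I_ne_zero, ?_⟩
  intro hL1 hDD hMR D ρ Λ m b hAF x e r mr hPR hx ns hns h hcont hconv
  obtain ⟨hρ, hflat1, hadm, hexh, hb⟩ := hAF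
  obtain ⟨hr, hflatx, hroot, he⟩ := hPR
  have hU : IsOpen D.carrier := D.isOpen
  obtain ⟨hxfr, hxU⟩ := mem_frontier_of_flat_piece D hr hflatx
  -- the carrier inside the punctured closed region
  have hsub : D.carrier ⊆ (D.carrier ∪
      (({z : ℂ | z.im = (D.pt 1).im} ∩ Metric.ball (D.pt 1) ρ) ∪ ({z : ℂ | z.im = x.im} ∩ Metric.ball x r))) \ {x} :=
    fun z hz => ⟨Or.inl hz, fun h' => hxU (by rw [Set.mem_singleton_iff] at h'; rw [← h']; exact hz)⟩
  have hhU : ContinuousOn h D.carrier := hcont.mono hsub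
  -- the hypotheses of the core files
  have hbd : ∀ᶠ δ : ℝ in 𝓝[>] 0, hexDomainSimplyConnected (Λ δ) ∧ e δ ∈ hexDomainBoundary (Λ δ) ∧
      b δ ∈ hexDomainBoundary (Λ δ) := by
    filter_upwards [hadm, hroot] with δ h1 h2 using ⟨h1.1, h2.1, h1.2.1⟩
  have hL1' := hL1 D ρ Λ m b ⟨hρ, hflat1, hadm, hexh, hb⟩ x e r mr ⟨hr, hflatx, hroot, he⟩ hx
  have hconv' : ∀ K : Set ℂ, IsCompact K → K ⊆ D.carrier → ∀ ε : ℝ, 0 < ε →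
      ∀ᶠ n : ℕ in atTop, ∀ H : Site 2 → ℂ, IsPotential (Λ (ns n)) (e (ns n)) H →
      ∀ (ub wb : HexVertex), b (ns n) = s(ub, wb) →
      ∀ sb : Site 2, sb ∈ hexFaceVertices ub → sb ∈ hexFaceVertices wb →
      ∀ s : Site 2, IsLatticeSite (Λ (ns n)) s → ((ns n : ℝ) : ℂ) * triEmbed s ∈ K →
        ‖((ns n : ℝ) : ℂ) * (H s - H sb) /
            hexParafermionicObservable (Λ (ns n)) (e (ns n)) hexCriticalFugacity (5 / 8) (b (ns n)) -
          h (((ns n : ℝ) : ℂ) * triEmbed s)‖ < ε :=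
    fun K hK hKU ε hε => hconv K hK (hKU.trans hsub) ε hε
  have hCCN := conjugateClassNegligible_of_exponent_cruxes hDD hMR
  have hroot' : ∀ᶠ δ : ℝ in 𝓝[>] 0, e δ ∈ hexDomainBoundary (Λ δ) ∧
      Nonempty (HexMidEdgeSAW (Λ δ) (e δ) (b δ)) := by
    filter_upwards [hroot] with δ hδ using ⟨hδ.1, hδ.2.1⟩
  have hCC := fun (φ : ℂ → ℂ) (hφ : ContDiff ℝ 1 φ) (hφc : HasCompactSupport φ)
      (hφU : tsupport φ ⊆ D.carrier) =>
    conjugateClass_tendsto_zero hCCN D ρ Λ m b hρ hflat1 hadm hexh hb x e r hr hflatx hroot' he hx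
      hns hφ hφc hφU
  ---------------------------------------------------------------- holomorphy
  have hhol : DifferentiableOn ℂ h D.carrier := by
    refine differentiableOn_of_integral_dbar hU hhU fun φ hφ hφc hφU => ?_
    obtain ⟨h2, h1⟩ := contDiff_two_of_smooth hφ
    exact integral_dbar_eq_zero Λ e b hU hexh hbd hL1' hns hhU hconv' h2 hφc hφU (hCC φ h1 hφc hφU)
  refine ⟨hhol, ?_⟩
  ---------------------------------------------------------------- the weak limit
  rintro ψ ⟨hψ, hψc, hψU⟩
  have hg : ContinuousOn (fun z => 12 * I * deriv h z) D.carrier :=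
    continuousOn_const.mul ((hhol.analyticOnNhd hU).deriv).continuousOn
  have key := tendsto_functional_of_smooth Λ e b hU hL1' hns hg (fun φ hφ hφc hφU => by
    obtain ⟨h2, h1⟩ := contDiff_two_of_smooth hφ
    have hlim := functional_limit_smooth Λ e b hU hexh hbd hL1' hns hhU hconv' h2 hφc hφU
    have hparts := integral_mul_wirtinger_d hU hhol h1 hφc hφU
    have hval : -(12 * I) * ∫ z, h z * ((2 : ℂ)⁻¹ * (fderiv ℝ φ z 1 - I * fderiv ℝ φ z I)) =
        ∫ z, φ z * (12 * I * deriv h z) := by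
      rw [hparts, mul_neg, neg_mul, neg_neg, ← integral_const_mul]
      exact integral_congr_ae (Eventually.of_forall fun z => by ring)
    rw [← hval]; exact hlim) hψ hψc hψU
  simpa only using key

end Summit.CriticalPhenomena.SAWScalingLimit.Theorems.PickHalfPlane.DevelopingMap

end
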